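import Mathlib
import Literature.NumberTheory.LFunctions.Zhang2022.Section12Lemma122Edge
import Literature.NumberTheory.LFunctions.Zhang2022.Section12Lemma123Edge
import HarnessLib

/-!
# Zhang (2022) §12, Lemmas 12.2–12.3: the deductions with MINIMAL hypotheses (only the undischarged
# analytic displays remain), and the consistency constraint the banked Lemma 12.3 imposes

Topic `Literature/NumberTheory/LFunctions/Zhang2022` (Landau–Siegel audit tree; verdict-neutral).
Y. Zhang, *Discrete mean estimates and the Landau–Siegel zero*, arXiv:2211.02515v1 (2022)
[Zhang2022LandauSiegel] — **an unrefereed manuscript under adjudication; nothing here asserts or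
denies its Theorems 1–2, and no claim about Landau–Siegel zeros is made.** Cell siegel-zhang, D-0069
campaign, discharge seat sz-d60. Companion of `Section12Lemma122Edge` / `Section12Lemma123Edge` (the
kernel deductions of Lemma 12.2's (12.10) and Lemma 12.3's evaluation form from L3-t5's typed proof
steps, `TypedSection12B`), now that L3-t5 has PROVED in the tree the exact identities among those
steps (`U023_holds`, `U027_holds`, `U029_holds`, `U031_holds`, `U033_holds`):

* `eq1210L15_of_u024_u025 : U024 c′ → U025 c′ → Eq1210L15 c′` — **(12.10) (rate `O(𝓛⁻¹⁵)`)
  rests on EXACTLY the two analytic displays u024 ("By (4) and (4) [sic] … = [Perron integral] +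
  O(𝓛⁻¹⁵)", tex L3528) and u025 ("In a way similar to the proof of Lemma 8.4 …", tex L3534)**;
  `lemma122L15_of_u024_u025_eq1211`, `ded122L15_of_u024_u025_eq1211` — Lemma 12.2 / its deduction
  node given in addition (12.11) (no printed proof; GAP row G-L3t5-2);
* `lemma123_form_of_u030 : U030 c′ → (evaluation form)`,
  `lemma123_printed_form_of_u030_u034 : U030 c′ → U034 c′ → (printed shape + O(𝓛⁻¹⁵))` — **Lemma
  12.3's evaluation rests on EXACTLY the analytic display u030** ("Assume `|w| = α`. In a way similar
  to the proof of Lemma 12.1 [sic] …", tex L3564);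
* `lemma123_banked_consistency : U030 c′ → Skeleton.Lemma123 c′ → …
  ‖L′(1,χ)‖‖Π(d,r)‖/log P₁ · ‖rhs033 − (1 − (−2β₆+β_{j+1}+β_{j+2})log(dr/P″₁))‖
  ≤ 10⁻⁵‖L′(1,χ)‖‖Π(d,r)‖/log P₁ + C(𝓛¹⁵)⁻¹` and, dividing by `|L′(1,χ)| ≥ c·D/φ(D) ≥ c` (Lemma
  5.7, a theorem of the tree, `Skeleton.lemma57_holds`) and `log P₁ = 0.504𝓛⁹`,
  `lemma123_banked_forces_eps2 : … ‖Π(d,r)‖·‖ε₂ⱼ(dr)‖ ≤ 10⁻⁵‖Π(d,r)‖ + C(𝓛⁶)⁻¹` — **the banked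
  leaf `Skeleton.Lemma123` (AS PRINTED, error exactly `10⁻⁵|L′Π|/log P₁`) together with its own
  proof's display u030 FORCES the printed numerical claim `|ε₂ⱼ(dr)| < 10⁻⁵` (u034) up to
  `O(𝓛⁻⁶/|Π(d,r)|)` at every `dr` in the range with `Π(d,r) ≠ 0`** (GAP row G-d60-2; the certified
  numerics N-07, `NumericsSection12.not_lemma123Pointwise_num_*`, report `sup|ε₂ⱼ| ≈ 6.6·10⁻⁴` in
  the large-`D` limit — the `C32` analogue of TEAM R's `C31` cone flag, CONDITIONAL on u030; turning
  it into `Lemma123 → U030 → ForAllLarge ¬(A)` needs the finite-`D` endpoint analysis of `rhs033`, as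
  `Section12Lemma121Printed.U019_fails_at_endpoint` does for Lemma 12.1 — not done here).

No new definitions, no new facts; standard axioms.

## References

* Y. Zhang, arXiv:2211.02515v1 (2022), §12 Lemmas 12.2–12.3 and their proofs, pp. 69–71,
  tex L3502–L3590; §5 Lemma 5.7. [cite: Zhang2022LandauSiegel, §12 Lemmas 12.2–12.3]
-/

noncomputable section

open Complex Real Metric Set

namespace Literature.NumberTheory.LFunctions.Zhang2022.Typed.Sec12B

open Literature.NumberTheory.LFunctions.Zhang2022.Skeleton

section MinimalHypotheses

variable (c' : ℝ)

/-- **(12.10) with the rate `O(𝓛⁻¹⁵)` from exactly the two analytic displays u024 and u025** (u023,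
u027 are theorems of the tree, `U023_holds`, `U027_holds`; the Cauchy step u026 is
`u026read_of_u024_u025`). [cite: Zhang2022LandauSiegel, §12 Lemma 12.2 (12.10), pp. 69–70] -/
theorem eq1210L15_of_u024_u025 (h24 : U024 c') (h25 : U025 c') : Eq1210L15 c' :=
  eq1210L15_of_steps c' (U023_holds c') (u026read_of_u024_u025 c' h24 h25) U027_holds

/-- **Lemma 12.2 (rate `O(𝓛⁻¹⁵)` for (12.10)) from u024, u025 and (12.11)** ((12.11): "The proof of
(12.11) is similar to that of ." — blank reference, GAP row G-L3t5-2).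
[cite: Zhang2022LandauSiegel, §12 Lemma 12.2, pp. 69–70] -/
theorem lemma122L15_of_u024_u025_eq1211 (h24 : U024 c') (h25 : U025 c') (h1211 : Eq1211 c') :
    Lemma122 c' (fun D => (ell D ^ 15)⁻¹) :=
  ⟨eq1210L15_of_u024_u025 c' h24 h25, h1211⟩

/-- **The deduction node `Ded122` (rate `O(𝓛⁻¹⁵)`) from u024, u025 and (12.11)**: its printed
antecedents Lemmas 8.2–8.4, 5.8 enter only through u024/u025.
[cite: Zhang2022LandauSiegel, §12 proof of Lemma 12.2, pp. 69–70, tex L3518] -/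
theorem ded122L15_of_u024_u025_eq1211 (h24 : U024 c') (h25 : U025 c') (h1211 : Eq1211 c') :
    Ded122 c' (fun D => (ell D ^ 15)⁻¹) :=
  fun _ _ _ _ => lemma122L15_of_u024_u025_eq1211 c' h24 h25 h1211

/-- **Lemma 12.3, evaluation form, from exactly the analytic display u030** (u029, u031, u033 are
theorems of the tree: `U029_holds`, `U031_holds`, `U033_holds`): for `P″₁ < dr < P₂`,
`Σ_l χ(l)ϰ̄₁₃(drl)ξ_j(l;d,r)/l = −(L′(1,χ)Π(d,r)/log P₁)·rhs033 + O(𝓛⁻¹⁵)`.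
[cite: Zhang2022LandauSiegel, §12 Lemma 12.3 (proof), pp. 70–71, tex L3558–L3586] -/
theorem lemma123_form_of_u030 (h30 : U030 c') :
    ∃ C : ℝ, ForAllLarge fun D _ χ => AssumptionA D χ →
      ∀ j ∈ ({1, 2, 3} : Finset ℕ), ∀ d r : ℕ, 1 ≤ d → 1 ≤ r →
        P1pp D < ((d * r : ℕ) : ℝ) → ((d * r : ℕ) : ℝ) < Skeleton.P2 D →
          ‖sum122 c' χ j d r +
              1 / (Real.log (Skeleton.P1 D) : ℂ) * (deriv χ.LFunction 1 * PiW χ d r) *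
                rhs033 c' D j d r‖ ≤ C * (ell D ^ 15)⁻¹ :=
  lemma123_form_of_steps c' (U029_holds c') h30 (U031_holds c') (U033_holds c')

/-- **Lemma 12.3 in its printed shape (additive `O(𝓛⁻¹⁵)` kept) from u030 and the printed numerical
claim u034.** [cite: Zhang2022LandauSiegel, §12 Lemma 12.3, pp. 70–71, tex L3551–L3590] -/
theorem lemma123_printed_form_of_u030_u034 (h30 : U030 c') (h34 : U034 c') :
    ∃ C : ℝ, ForAllLarge fun D _ χ => AssumptionA D χ →
      ∀ j ∈ ({1, 2, 3} : Finset ℕ), ∀ d r : ℕ, 1 ≤ d → 1 ≤ r →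
        P1pp D < ((d * r : ℕ) : ℝ) → ((d * r : ℕ) : ℝ) < Skeleton.P2 D →
          ‖sum122 c' χ j d r -
              deriv χ.LFunction 1 * PiW χ d r / (Real.log (Skeleton.P1 D) : ℂ) *
                (-1 + (-2 * beta6 D + betaJ c' D (j + 1) + betaJ c' D (j + 2)) *
                  (Real.log (((d * r : ℕ) : ℝ) / P1pp D) : ℂ))‖ ≤
            1e-5 * ‖deriv χ.LFunction 1‖ * ‖PiW χ d r‖ / Real.log (Skeleton.P1 D) +
              C * (ell D ^ 15)⁻¹ :=
  lemma123_printed_form_of_steps c' (U029_holds c') h30 (U031_holds c') (U033_holds c') h34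

end MinimalHypotheses

/-! ## The consistency constraint imposed by the banked Lemma 12.3 -/

section BankedConsistency

variable (c' : ℝ)

/-- `log P₁ = 0.504𝓛⁹ > 0` for `D ≥ 3`. [cite: Zhang2022LandauSiegel, §2 (2.21)] -/
private theorem log_P1_eq'' (D : ℕ) : Real.log (Skeleton.P1 D) = 0.504 * ell D ^ 9 := by
  rw [Skeleton.P1, Real.log_rpow (by rw [bigP]; exact Real.exp_pos _), bigP, Real.log_exp]

/-- `log P₁ > 0` for `D ≥ 3`. [cite: Zhang2022LandauSiegel, §2 (2.21)] -/
private theorem log_P1_pos'' {D : ℕ} (hD : 3 ≤ D) : 0 < Real.log (Skeleton.P1 D) := by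
  rw [log_P1_eq'']; exact mul_pos (by norm_num) (pow_pos (by linarith [one_lt_ell hD]) _)

/-- **The banked `Skeleton.Lemma123` (AS PRINTED) together with u030 constrains the main term's
numerics**: for `P″₁ < dr < P₂`,
`(‖L′(1,χ)‖‖Π(d,r)‖/log P₁)·‖rhs033 − (1 − (−2β₆+β_{j+1}+β_{j+2})log(dr/P″₁))‖
 ≤ 10⁻⁵·‖L′(1,χ)‖‖Π(d,r)‖/log P₁ + C(𝓛¹⁵)⁻¹`
(subtract the two evaluations of the same `l`-sum: the banked one and `lemma123_form_of_u030`).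
The bracketed difference is the manuscript's `−ε₂ⱼ(dr)` (u034).
[cite: Zhang2022LandauSiegel, §12 Lemma 12.3, p. 70 tex L3551–L3552, p. 71 tex L3587–L3590] -/
theorem lemma123_banked_consistency (h30 : U030 c') (h123 : Skeleton.Lemma123 c') :
    ∃ C : ℝ, ForAllLarge fun D _ χ => AssumptionA D χ →
      ∀ j ∈ ({1, 2, 3} : Finset ℕ), ∀ d r : ℕ, 1 ≤ d → 1 ≤ r →
        P1pp D < ((d * r : ℕ) : ℝ) → ((d * r : ℕ) : ℝ) < Skeleton.P2 D →
          ‖deriv χ.LFunction 1‖ * ‖PiW χ d r‖ / Real.log (Skeleton.P1 D) *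
              ‖rhs033 c' D j d r -
                (1 - (-2 * beta6 D + betaJ c' D (j + 1) + betaJ c' D (j + 2)) *
                  (Real.log (((d * r : ℕ) : ℝ) / P1pp D) : ℂ))‖ ≤
            1e-5 * ‖deriv χ.LFunction 1‖ * ‖PiW χ d r‖ / Real.log (Skeleton.P1 D) +
              C * (ell D ^ 15)⁻¹ := by
  obtain ⟨C, hC⟩ := lemma123_form_of_u030 c' h30
  obtain ⟨D₀, hall⟩ := hC.and h123
  refine ⟨C, max D₀ 3, fun D _ χ hD hq hp hA j hj d r hd hr h1 h2 => ?_⟩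
  have hD₀ : D₀ ≤ D := le_trans (le_max_left _ _) hD
  have hD3 : 3 ≤ D := le_trans (le_max_right _ _) hD
  obtain ⟨kC, k123⟩ := hall D χ hD₀ hq hp
  have eC := kC hA j hj d r hd hr h1 h2
  have e123 : ‖sum122 c' χ j d r -
      deriv χ.LFunction 1 * PiW χ d r / Real.log (Skeleton.P1 D) *
        (-1 + (-2 * beta6 D + betaJ c' D (j + 1) + betaJ c' D (j + 2)) *
          (Real.log (((d * r : ℕ) : ℝ) / P1pp D) : ℂ))‖ ≤
      1e-5 * ‖deriv χ.LFunction 1‖ * ‖PiW χ d r‖ / Real.log (Skeleton.P1 D) :=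
    k123 hA j hj d r hd hr h1 h2
  have hlogP1 : 0 < Real.log (Skeleton.P1 D) := log_P1_pos'' hD3
  set L : ℂ := deriv χ.LFunction 1 * PiW χ d r with hL
  set ρ : ℂ := rhs033 c' D j d r -
    (1 - (-2 * beta6 D + betaJ c' D (j + 1) + betaJ c' D (j + 2)) *
      (Real.log (((d * r : ℕ) : ℝ) / P1pp D) : ℂ)) with hρ
  -- the difference of the two evaluations is `(L/log P₁)·ρ`
  have hid : L / (Real.log (Skeleton.P1 D) : ℂ) * ρ =
      (sum122 c' χ j d r + 1 / (Real.log (Skeleton.P1 D) : ℂ) * L * rhs033 c' D j d r) -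
        (sum122 c' χ j d r - L / (Real.log (Skeleton.P1 D) : ℂ) *
          (-1 + (-2 * beta6 D + betaJ c' D (j + 1) + betaJ c' D (j + 2)) *
            (Real.log (((d * r : ℕ) : ℝ) / P1pp D) : ℂ))) := by
    rw [hρ]; ring
  have hnorm : ‖L / (Real.log (Skeleton.P1 D) : ℂ) * ρ‖ =
      ‖deriv χ.LFunction 1‖ * ‖PiW χ d r‖ / Real.log (Skeleton.P1 D) * ‖ρ‖ := by
    rw [norm_mul, norm_div, hL, norm_mul, Complex.norm_real, Real.norm_eq_abs, abs_of_pos hlogP1]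
  rw [← hnorm, hid]
  refine (norm_sub_le _ _).trans ?_
  rw [add_comm]
  exact add_le_add (by rw [hL] at e123 ⊢; exact e123) eC

/-- **The banked Lemma 12.3 forces the printed `|ε₂ⱼ(dr)| < 10⁻⁵` up to `O(𝓛⁻⁶/|Π(d,r)|)`**
(CONDITIONAL on u030): dividing `lemma123_banked_consistency` by `|L′(1,χ)| ≥ c > 0` (Lemma 5.7 under
(A): `L′(1,χ) ≥ c·D/φ(D) ≥ c`, tree theorem `Skeleton.lemma57_holds`) and multiplying by
`log P₁ = 0.504𝓛⁹`: `‖Π(d,r)‖·‖ε₂ⱼ(dr)‖ ≤ 10⁻⁵‖Π(d,r)‖ + C(𝓛⁶)⁻¹` on `P″₁ < dr < P₂`. Where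
`Π(d,r) ≠ 0` this is the printed numerical claim u034 up to `o(1)`, which the certified numerics N-07
report FALSE by a factor ≈ 60 (`NumericsSection12.not_lemma123Pointwise_num_*`, large-`D` limit):
the `C32` analogue, conditional on u030, of TEAM R's `C31` flag (`Section12Lemma121Printed`).
[cite: Zhang2022LandauSiegel, §12 Lemma 12.3, pp. 70–71; §5 Lemma 5.7] -/
theorem lemma123_banked_forces_eps2 (h30 : U030 c') (h123 : Skeleton.Lemma123 c') :
    ∃ C : ℝ, ForAllLarge fun D _ χ => AssumptionA D χ →
      ∀ j ∈ ({1, 2, 3} : Finset ℕ), ∀ d r : ℕ, 1 ≤ d → 1 ≤ r →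
        P1pp D < ((d * r : ℕ) : ℝ) → ((d * r : ℕ) : ℝ) < Skeleton.P2 D →
          ‖PiW χ d r‖ *
              ‖rhs033 c' D j d r -
                (1 - (-2 * beta6 D + betaJ c' D (j + 1) + betaJ c' D (j + 2)) *
                  (Real.log (((d * r : ℕ) : ℝ) / P1pp D) : ℂ))‖ ≤
            1e-5 * ‖PiW χ d r‖ + C * (ell D ^ 6)⁻¹ := by
  obtain ⟨C, hC⟩ := lemma123_banked_consistency c' h30 h123
  obtain ⟨c, hc, h57⟩ := lemma57_holds
  obtain ⟨D₀, hall⟩ := hC.and h57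
  refine ⟨|C| * 0.504 / c, max D₀ 3, fun D _ χ hD hq hp hA j hj d r hd hr h1 h2 => ?_⟩
  have hD₀ : D₀ ≤ D := le_trans (le_max_left _ _) hD
  have hD3 : 3 ≤ D := le_trans (le_max_right _ _) hD
  obtain ⟨kC, k57⟩ := hall D χ hD₀ hq hp
  have e := kC hA j hj d r hd hr h1 h2
  have hℓ : 0 < ell D := by linarith [one_lt_ell hD3]
  -- `|L′(1,χ)| ≥ c`
  have hL' : c ≤ ‖deriv χ.LFunction 1‖ := by
    have h1 := k57 hA
    have hD0 : (0 : ℝ) < D := by exact_mod_cast (lt_of_lt_of_le (by norm_num) hD3 : 0 < D)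
    have hφ : (Nat.totient D : ℝ) ≤ D := by exact_mod_cast Nat.totient_le D
    have hφ0 : (0 : ℝ) < Nat.totient D := by
      exact_mod_cast Nat.totient_pos.mpr (lt_of_lt_of_le (by norm_num) hD3)
    have hge1 : 1 ≤ (D : ℝ) / Nat.totient D := (one_le_div hφ0).mpr hφ
    calc c = c * 1 := (mul_one c).symm
      _ ≤ c * ((D : ℝ) / Nat.totient D) := mul_le_mul_of_nonneg_left hge1 hc.le
      _ ≤ (deriv χ.LFunction 1).re := h1
      _ ≤ ‖deriv χ.LFunction 1‖ := Complex.re_le_norm _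
  have hlogP1 : Real.log (Skeleton.P1 D) = 0.504 * ell D ^ 9 := log_P1_eq'' D
  have hlog0 : 0 < Real.log (Skeleton.P1 D) := log_P1_pos'' hD3
  set X : ℝ := ‖PiW χ d r‖ *
    ‖rhs033 c' D j d r -
      (1 - (-2 * beta6 D + betaJ c' D (j + 1) + betaJ c' D (j + 2)) *
        (Real.log (((d * r : ℕ) : ℝ) / P1pp D) : ℂ))‖ with hX
  have hX0 : 0 ≤ X := by positivity
  -- from `e`: (‖L′‖/log P₁)·(X − 10⁻⁵‖Π‖) ≤ C𝓛⁻¹⁵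
  have e' : ‖deriv χ.LFunction 1‖ / Real.log (Skeleton.P1 D) * (X - 1e-5 * ‖PiW χ d r‖) ≤
      C * (ell D ^ 15)⁻¹ := by
    have hrw : ‖deriv χ.LFunction 1‖ / Real.log (Skeleton.P1 D) * (X - 1e-5 * ‖PiW χ d r‖) =
        ‖deriv χ.LFunction 1‖ * ‖PiW χ d r‖ / Real.log (Skeleton.P1 D) *
            ‖rhs033 c' D j d r -
              (1 - (-2 * beta6 D + betaJ c' D (j + 1) + betaJ c' D (j + 2)) *
                (Real.log (((d * r : ℕ) : ℝ) / P1pp D) : ℂ))‖ -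
          1e-5 * ‖deriv χ.LFunction 1‖ * ‖PiW χ d r‖ / Real.log (Skeleton.P1 D) := by
      rw [hX]; ring
    rw [hrw]
    linarith [e]
  -- divide by `‖L′‖/log P₁ ≥ c/log P₁`
  by_cases hcase : X - 1e-5 * ‖PiW χ d r‖ ≤ 0
  · have : 0 ≤ |C| * 0.504 / c * (ell D ^ 6)⁻¹ := by positivity
    linarith
  · have hcase : 0 < X - 1e-5 * ‖PiW χ d r‖ := not_le.mp hcase
    have hq : c / Real.log (Skeleton.P1 D) * (X - 1e-5 * ‖PiW χ d r‖) ≤ C * (ell D ^ 15)⁻¹ :=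
      le_trans (mul_le_mul_of_nonneg_right (div_le_div_of_nonneg_right hL' hlog0.le) hcase.le) e'
    have hq' : X - 1e-5 * ‖PiW χ d r‖ ≤ C * (ell D ^ 15)⁻¹ * Real.log (Skeleton.P1 D) / c := by
      rw [le_div_iff₀ hc, ← sub_nonneg]
      have : 0 ≤ C * (ell D ^ 15)⁻¹ - c / Real.log (Skeleton.P1 D) * (X - 1e-5 * ‖PiW χ d r‖) :=
        sub_nonneg.mpr hq
      have hrw : C * (ell D ^ 15)⁻¹ * Real.log (Skeleton.P1 D) -
          (X - 1e-5 * ‖PiW χ d r‖) * c =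
          Real.log (Skeleton.P1 D) *
            (C * (ell D ^ 15)⁻¹ - c / Real.log (Skeleton.P1 D) * (X - 1e-5 * ‖PiW χ d r‖)) := by
        field_simp
      rw [hrw]
      exact mul_nonneg hlog0.le this
    have hval : C * (ell D ^ 15)⁻¹ * Real.log (Skeleton.P1 D) / c ≤ |C| * 0.504 / c * (ell D ^ 6)⁻¹ := by
      rw [hlogP1]
      have h9 : ell D ^ 9 ≠ 0 := pow_ne_zero _ hℓ.ne'
      have hCabs : C * (ell D ^ 15)⁻¹ * (0.504 * ell D ^ 9) / c ≤
          |C| * (ell D ^ 15)⁻¹ * (0.504 * ell D ^ 9) / c := by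
        gcongr; exact le_abs_self C
      refine hCabs.trans (le_of_eq ?_)
      field_simp
    linarith

end BankedConsistency

end Literature.NumberTheory.LFunctions.Zhang2022.Typed.Sec12B
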